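import Literature.NumberTheory.Automorphic.AdeleAwayMatrixTwoConjugacy
import Literature.NumberTheory.Automorphic.ScalarExtensionMatrixTraceDet
import Literature.NumberTheory.Automorphic.QuaternionGLTwoClassesEmbedding
import HarnessLib

/-!
# Matched elliptic elements of `Dˣ` and `GL₂(K)` are conjugate in `GL₂(𝔸_K^S)`
(Gelbart, *Automorphic forms on adele groups* (1975), §10, pp. 154–155)

Topic `NumberTheory/Automorphic`; theorems only (no definition, no named fact, no instance).

Gelbart (1975), p. 154: the elliptic terms of (10.14) are indexed by `γ ∈ G'_F = Dˣ` modulo conjugacy,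
"each `γ` … lies in some separable quadratic extension `L`", those of (10.15) by the `γ ∈ GL₂(F)` with
irreducible characteristic polynomial; the two are matched by the characteristic polynomial
(`quaternionToGLTwoClass`: `(trd, nrd)(γ') = (tr, det)(γ)`), and p. 155 identifies the orbital
integrals away from `S` through `G'^S = G^S`. The identification presupposes that, under a splitting
`Ψ : 𝔸_K^S ⊗_K D ≃ M₂(𝔸_K^S)` of `D` over the adeles away from `S` (`QuaternionAdeleAwaySplitting`), the
image `Ψ(1 ⊗ γ')` is `GL₂(𝔸_K^S)`-conjugate to `γ`; this file proves it:

* `linearIndependent_one_of_not_mem_bot` — `1, γ'` are `K`-independent for `γ' ∉ K`;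
* `discr_ne_zero_of_not_mem_bot` — `trd(γ')² - 4 nrd(γ') ≠ 0` for `γ' ∉ K` in a division quaternion
  algebra (the quadratic `X² - trd X + nrd` is irreducible, `irreducible_quadratic_of_not_mem_bot`);
* `Quat.exists_units_conj_algEquiv_incl_eq_map` — **for any `𝔸_K^S`-algebra splitting `Ψ` and
  `γ' ∈ D ∖ K`, `γ ∈ M₂(K)` with `tr γ = trd γ'`, `det γ = nrd γ'` (`D` division), there is
  `Q ∈ GL₂(𝔸_K^S)` with `Q Ψ(1 ⊗ γ') Q⁻¹ = γ`** (`ScalarExtension.trace_det_algEquiv_incl_eq_reduced` +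
  `exists_units_conj_eq_adeleAway`).

Part of the inline (D-0026) decomposition of
`Literature.NumberTheory.Automorphic.strong_multiplicity_one_quaternionUnits`.

## References

* S. Gelbart, *Automorphic forms on adele groups*, Ann. of Math. Studies 83 (1975), §10, pp. 154–155
  [Gelbart1975].
-/

noncomputable section

open NumberField IsDedekindDomain Matrix Polynomial

universe u

namespace Literature.NumberTheory.Automorphic

section Rational

variable (K : Type*) [Field K] (D : Type*) [Ring D] [Algebra K D]

/-- `1, γ'` are `K`-linearly independent for `γ' ∉ K · 1`. [folklore] -/
theorem linearIndependent_one_of_not_mem_bot [Nontrivial D] {γ' : D} (hγ' : γ' ∉ (⊥ : Subalgebra K D)) :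
    LinearIndependent K ![(1 : D), γ'] := by
  refine LinearIndependent.pair_iff.2 fun s t hst => ?_
  by_cases ht : t = 0
  · subst ht
    rw [zero_smul, add_zero, smul_eq_zero] at hst
    exact ⟨hst.resolve_right one_ne_zero, rfl⟩
  · exfalso
    apply hγ'
    have h1 : t • γ' = -(s • (1 : D)) := eq_neg_of_add_eq_zero_right hst
    have h2 : γ' = (-(t⁻¹ * s)) • (1 : D) := by
      calc γ' = t⁻¹ • (t • γ') := by rw [smul_smul, inv_mul_cancel₀ ht, one_smul]
        _ = (-(t⁻¹ * s)) • (1 : D) := by rw [h1, smul_neg, smul_smul, neg_smul]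
    rw [h2, ← Algebra.algebraMap_eq_smul_one]
    exact Subalgebra.algebraMap_mem _ _

end Rational

section Division

variable (K : Type) [Field K] [CharZero K] (D : Type u) [Ring D] [Algebra K D] [IsQuaternionAlgebra K D]

/-- **`trd(γ')² - 4 nrd(γ') ≠ 0` for `γ' ∉ K` in a division quaternion algebra**: the quadratic
`X² - trd(γ') X + nrd(γ')` is irreducible (`irreducible_quadratic_of_not_mem_bot`), so its discriminant
is not a square, in particular non-zero. [cite: Gelbart1975, §10 p. 154] -/
theorem discr_ne_zero_of_not_mem_bot (hD : ∀ x : D, x ≠ 0 → IsUnit x) {γ' : D} (hγ' : γ' ∉ (⊥ : Subalgebra K D)) :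
    reducedTrace K D γ' ^ 2 - 4 * reducedNorm K D γ' ≠ 0 := by
  haveI : NeZero (2 : K) := ⟨two_ne_zero⟩
  have h := (irreducible_quadratic_iff_not_isSquare_discr _ _).1 (irreducible_quadratic_of_not_mem_bot K D hD hγ')
  exact fun h0 => h ⟨0, by rw [h0, mul_zero]⟩

end Division

section Away

variable (K : Type) [Field K] [NumberField K] (D : Type u) [Ring D] [Algebra K D] [IsQuaternionAlgebra K D]
  (S : Finset (HeightOneSpectrum (𝓞 K)))

/-- **Matched elliptic elements are conjugate in `GL₂(𝔸_K^S)`.** Let `D` be a division quaternion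
algebra over `K`, `Ψ : 𝔸_K^S ⊗_K D ≃ₐ[𝔸_K^S] M₂(𝔸_K^S)` any splitting of `D` over the adeles away from a
finite set `S` of finite places, `γ' ∈ D ∖ K`, and `γ ∈ M₂(K)` with `tr γ = trd γ'`, `det γ = nrd γ'`
(the matching of elliptic classes, `quaternionToGLTwoClass`). Then `Q Ψ(1 ⊗ γ') Q⁻¹ = γ` for some
`Q ∈ GL₂(𝔸_K^S)` — so the orbital integrals of `Ψ(γ')` and `γ` over `G^S = GL₂(𝔸_K^S)` agree.
[cite: Gelbart1975, §10 pp. 154–155] -/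
theorem Quat.exists_units_conj_algEquiv_incl_eq_map (hD : ∀ x : D, x ≠ 0 → IsUnit x)
    (Ψ : ScalarExtension K (AdeleAway K S) D ≃ₐ[AdeleAway K S] Matrix (Fin 2) (Fin 2) (AdeleAway K S))
    {γ' : D} (hγ' : γ' ∉ (⊥ : Subalgebra K D)) (γ : Matrix (Fin 2) (Fin 2) K)
    (ht : γ.trace = reducedTrace K D γ') (hd : γ.det = reducedNorm K D γ') :
    ∃ Q : GL (Fin 2) (AdeleAway K S), (Q : Matrix (Fin 2) (Fin 2) (AdeleAway K S)) *
        Ψ (ScalarExtension.incl K (AdeleAway K S) D γ') * ((Q⁻¹ : GL (Fin 2) (AdeleAway K S)) : Matrix (Fin 2) (Fin 2) (AdeleAway K S)) =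
      γ.map (algebraMap K (AdeleAway K S)) := by
  haveI : Nontrivial D := Module.nontrivial_of_finrank_pos (R := K)
    (by rw [IsQuaternionAlgebra.finrank_eq_four (K := K) (D := D)]; omega)
  have hind := linearIndependent_one_of_not_mem_bot K D hγ'
  obtain ⟨htr, hdet⟩ := ScalarExtension.trace_det_algEquiv_incl_eq_reduced K (AdeleAway K S) D Ψ hind
  refine exists_units_conj_eq_adeleAway K S (discr_ne_zero_of_not_mem_bot K D hD hγ') _ _ htr hdet ?_ ?_
  · rw [← AddMonoidHom.map_trace (algebraMap K (AdeleAway K S)) γ, ht]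
  · rw [← RingHom.mapMatrix_apply, ← RingHom.map_det, hd]

end Away

end Literature.NumberTheory.Automorphic
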